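import Literature.Computability.Complexity.HeldKarpSymmetricCircuit

/-!
# Renaming the inputs of a DAG circuit; Held–Karp on an invariant induced subgraph

Everything PROVED; no named facts. Two additions to `CircuitDAG.lean` / `HeldKarpSymmetricCircuit.lean`:

* `GateDAG.mapInputs e D` — the DAG circuit `D` with every input wire `i` renamed `e i`
  (`val_mapInputs`, `evalOut_mapInputs`), and the transport of automorphisms along an
  intertwining renaming (`GateDAG.IsAut.mapInputs`: if `π' ∘ e = e ∘ π` then an automorphism of `D`
  over `π` is one of `D.mapInputs e` over `π'`).
* `HeldKarp.hasSymCircuit_ham_induced` — for an embedding `emb : Fin g ↪ Fin m` of `g ≥ 3`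
  vertices and any set `Γ` of permutations of `Fin m` mapping the image of `emb` into itself, the
  function `x ↦ [the subgraph of Gr x induced on the image of emb is Hamiltonian]` of an `m × m`
  matrix has a `Γ`-symmetric `tcBasis` circuit with at most `7·2^g·g³` gates: the Held–Karp
  programme on `g` vertices with renamed inputs. At `g = ⌊log₂ m⌋` this is POLYNOMIAL in `m`.

Consumer: crux `WindowHam` of route PneNP/SymmetryBudget (stmt-PneNP-2143) — the route's own
"cheapest falsifier": Hamiltonicity OF THE FREE PART (the last `⌊log₂ m⌋` vertices, preserved by
the budget group) has polynomial-size window-symmetric circuits, so the natural strengthening of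
the crux to functions of the free block alone is false; any lower bound must use the interaction
of the free block with the ordered block.

## References

* M. Held, R. M. Karp, J. SIAM 10 (1962) 196–210.
* H. Vollmer, *Introduction to Circuit Complexity* (1999), §1.2 (projections / renaming inputs).
* M. Anderson, A. Dawar, Theory Comput. Syst. 60 (2017), §2.
-/

namespace Literature.Computability.Complexity

namespace GateDAG

variable {ι κ Λ : Type*}

/-- The child relation is unchanged by renaming inputs. [folklore] -/
theorem map_eq_inr_iff (e : ι → κ) (w : ι ⊕ Λ) (m : Λ) : w.map e id = Sum.inr m ↔ w = Sum.inr m := by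
  cases w with
  | inl i => simp
  | inr m' => simp

/-- **Renaming the inputs of a DAG circuit** along `e : ι → κ`: same gates, same gate functions,
input wire `i` becomes `e i`. [cite: Vollmer1999, §1.2] -/
def mapInputs (e : ι → κ) (D : GateDAG ι Λ) : GateDAG κ Λ where
  fn := D.fn
  args l a := (D.args l a).map e id
  out := D.out.map e id
  wf := by
    have h : (fun m l => ∃ a, (D.args l a).map e id = Sum.inr m) = fun m l => ∃ a, D.args l a = Sum.inr m := by
      funext m l
      simp only [map_eq_inr_iff]
    rw [h]
    exact D.wf

/-- Gate functions are unchanged. [folklore] -/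
@[simp] theorem mapInputs_fn (e : ι → κ) (D : GateDAG ι Λ) (l : Λ) : (D.mapInputs e).fn l = D.fn l := rfl

/-- **Semantics of renaming**: gate `l` of `D.mapInputs e` on input `u` has the value of gate `l`
of `D` on `u ∘ e`. [cite: Vollmer1999, §1.2] -/
theorem val_mapInputs (e : ι → κ) (D : GateDAG ι Λ) (u : κ → Bool) (l : Λ) :
    (D.mapInputs e).val u l = D.val (u ∘ e) l := by
  induction l using D.wf.induction with
  | _ l ih =>
    rw [val_eq, val_eq]
    show (D.fn l).2 _ = (D.fn l).2 _
    refine congrArg (D.fn l).2 (funext fun a => ?_)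
    show wire u ((D.mapInputs e).val u) ((D.args l a).map e id) = wire (u ∘ e) (D.val (u ∘ e)) (D.args l a)
    cases h : D.args l a with
    | inl i => rfl
    | inr m =>
      simp only [Sum.map_inr, id_eq, wire_inr]
      exact ih m ⟨a, h⟩

/-- The output of the renamed DAG. [cite: Vollmer1999, §1.2] -/
theorem evalOut_mapInputs (e : ι → κ) (D : GateDAG ι Λ) (u : κ → Bool) :
    (D.mapInputs e).evalOut u = D.evalOut (u ∘ e) := by
  show wire u ((D.mapInputs e).val u) (D.out.map e id) = wire (u ∘ e) (D.val (u ∘ e)) D.out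
  rcases hD : D.out with i | m
  · rfl
  · simp only [Sum.map_inr, id_eq, wire_inr]
    exact val_mapInputs e D u m

/-- **Automorphisms transport along an intertwining renaming**: if `π' (e i) = e (π i)` for all
`i`, an automorphism `θ` of `D` over `π` is an automorphism of `D.mapInputs e` over `π'`.
[cite: AndersonDawar2016, §2] -/
theorem IsAut.mapInputs {D : GateDAG ι Λ} {π : ι → ι} {θ : Λ ≃ Λ} (h : D.IsAut π θ) (e : ι → κ)
    {π' : κ → κ} (hcomm : ∀ i, π' (e i) = e (π i)) : (D.mapInputs e).IsAut π' θ := by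
  have key : ∀ w : ι ⊕ Λ, Sum.map π' θ (w.map e id) = (Sum.map π θ w).map e id := by
    intro w
    cases w with
    | inl i => simp [hcomm]
    | inr m => simp
  refine ⟨?_, h.fn_eq, fun l => ?_⟩
  · show Sum.map π' θ (D.out.map e id) = D.out.map e id
    rw [key, h.out_eq]
  · show (List.ofFn fun a => (D.args (θ l) a).map e id).Perm
      ((List.ofFn fun a => (D.args l a).map e id).map (Sum.map π' θ))
    have e1 : (List.ofFn fun a => (D.args (θ l) a).map e id) =
        (List.ofFn (D.args (θ l))).map (fun w => w.map e id) := by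
      rw [List.map_ofFn]
      rfl
    have e2 : (List.ofFn fun a => (D.args l a).map e id).map (Sum.map π' θ) =
        ((List.ofFn (D.args l)).map (Sum.map π θ)).map (fun w => w.map e id) := by
      rw [List.map_ofFn, List.map_ofFn, List.map_ofFn]
      congr 1
      funext a
      exact key _
    rw [e1, e2]
    exact (h.args_perm l).map _

end GateDAG

namespace HeldKarp

open Finset

variable {m g : ℕ}

/-- The renaming of matrix entries along a vertex map. [folklore] -/
def pairMap (emb : Fin g → Fin m) : Fin g × Fin g → Fin m × Fin m := fun q => (emb q.1, emb q.2)

/-- **The Held–Karp programme on `g` vertices reading the entries of an `m × m` matrix inside the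
image of `emb`** (Hamiltonicity of the induced subgraph on that image). [folklore] -/
noncomputable def inducedDAG (emb : Fin g → Fin m) : GateDAG (Fin m × Fin m) (HKNode g) :=
  (hkDAG g).mapInputs (pairMap emb)

/-- A permutation mapping the image of an embedding into itself restricts to a permutation of the
source. [folklore] -/
theorem exists_perm_restrict (emb : Fin g ↪ Fin m) (ρ : Equiv.Perm (Fin m))
    (hρ : ∀ i, ∃ j, ρ (emb i) = emb j) : ∃ ρ' : Equiv.Perm (Fin g), ∀ i, ρ (emb i) = emb (ρ' i) := by
  choose f hf using hρ
  have hinj : Function.Injective f := fun i j hij => by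
    apply emb.injective
    apply ρ.injective
    rw [hf i, hf j, hij]
  exact ⟨Equiv.ofBijective f (Finite.injective_iff_bijective.1 hinj), fun i => hf i⟩

/-- **Symmetry**: under every `Γ` mapping the image of `emb` into itself, the induced Held–Karp
programme is `Γ`-symmetric (the restricted permutation acts on the gate indices). [folklore] -/
theorem compile_inducedDAG_isSymmetricUnder (emb : Fin g ↪ Fin m) (Γ : Set (Equiv.Perm (Fin m)))
    (hΓ : ∀ ρ ∈ Γ, ∀ i, ∃ j, ρ (emb i) = emb j) :
    (inducedDAG emb).compile.IsSymmetricUnder Γ := by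
  rw [GateDAG.isSymmetricUnder_compile_iff]
  rintro π ⟨ρ, hρ, rfl⟩
  obtain ⟨ρ', hρ'⟩ := exists_perm_restrict emb ρ (hΓ ρ hρ)
  refine ⟨HKNode.actEquiv ρ', ?_⟩
  refine (hkDAG_isAut ρ').mapInputs (pairMap emb) (π' := fun q : Fin m × Fin m => (ρ q.1, ρ q.2)) fun q => ?_
  show (ρ (emb q.1), ρ (emb q.2)) = (emb (ρ' q.1), emb (ρ' q.2))
  rw [hρ', hρ']

open scoped Classical in
/-- **Semantics**: the induced programme decides Hamiltonicity of the pulled-back graph (`g ≥ 3`). [folklore] -/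
theorem compile_inducedDAG_eval (hg : 3 ≤ g) (emb : Fin g → Fin m) (x : Fin m × Fin m → Bool) :
    (inducedDAG emb).compile.eval x =
      decide (SimpleGraph.fromRel fun u v => x (emb u, emb v) = true : SimpleGraph (Fin g)).IsHamiltonian := by
  rw [GateDAG.compile_eval, inducedDAG, GateDAG.evalOut_mapInputs, ← GateDAG.compile_eval]
  exact compile_hkDAG_eval _ hg

open scoped Classical in
/-- **Held–Karp on an invariant induced subgraph.** For `g ≥ 3`, an embedding `emb : Fin g ↪ Fin m`
and any `Γ` mapping its image into itself, `x ↦ [the subgraph of Gr x induced on the image of emb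
is Hamiltonian]` has a `Γ`-symmetric `tcBasis` circuit with at most `7·2^g·g³` gates. [folklore] -/
theorem hasSymCircuit_ham_induced (hg : 3 ≤ g) (emb : Fin g ↪ Fin m) (Γ : Set (Equiv.Perm (Fin m)))
    (hΓ : ∀ ρ ∈ Γ, ∀ i, ∃ j, ρ (emb i) = emb j) :
    HasSymCircuit tcBasis Γ (7 * (2 ^ g * g ^ 3))
      (fun x : Fin m × Fin m → Bool =>
        decide (SimpleGraph.fromRel fun u v => x (emb u, emb v) = true : SimpleGraph (Fin g)).IsHamiltonian) := by
  refine ⟨(inducedDAG emb).compile, (inducedDAG emb).compile_isOver hkDAG_fn_mem_tcBasis, ?_,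
    compile_inducedDAG_isSymmetricUnder emb Γ hΓ, fun x => compile_inducedDAG_eval hg emb x⟩
  show (inducedDAG emb).compile.gates.length ≤ _
  rw [GateDAG.compile_gates_length]
  exact card_hkNode_le (by omega)

/-! ### The free block of the symmetry budget -/

/-- The `i`-th FREE vertex `m - g + i` (for `g ≤ m`). [folklore] -/
def freeEmb (m g : ℕ) (hg : g ≤ m) : Fin g ↪ Fin m :=
  ⟨fun i => ⟨m - g + i, by omega⟩, fun i j h => by
    apply Fin.ext
    have := Fin.mk.inj_iff.1 h
    omega⟩

/-- The coordinates of the free vertices. [folklore] -/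
@[simp] theorem coe_freeEmb (hg : g ≤ m) (i : Fin g) : ((freeEmb m g hg i : Fin m) : ℕ) = m - g + i := rfl

/-- Budget permutations map free vertices to free vertices. [folklore] -/
theorem budget_maps_free (hg : g ≤ m) {ρ : Equiv.Perm (Fin m)} (hρ : ρ ∈ pointStabiliserBudget m g)
    (i : Fin g) : ∃ j, ρ (freeEmb m g hg i) = freeEmb m g hg j := by
  have hmem : freeEmb m g hg i ∈ freeBlock m g := by
    rw [mem_freeBlock, coe_freeEmb]
    omega
  have h2 := apply_mem_freeBlock hρ hmem
  rw [mem_freeBlock] at h2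
  refine ⟨⟨(ρ (freeEmb m g hg i) : ℕ) - (m - g), by have := (ρ (freeEmb m g hg i)).2; omega⟩, ?_⟩
  apply Fin.ext
  simp only [coe_freeEmb]
  omega

open scoped Classical in
/-- **Hamiltonicity of the FREE PART has small budget-symmetric circuits**: for `3 ≤ g ≤ m`,
`x ↦ [the subgraph of Gr x induced on the last g vertices is Hamiltonian]` has a
`pointStabiliserBudget m g`-symmetric `tcBasis` circuit with at most `7·2^g·g³` gates — polynomial
in `m` at the window `g = ⌊log₂ m⌋`. [folklore] -/
theorem hasSymCircuit_ham_freePart (hg : 3 ≤ g) (hgm : g ≤ m) :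
    HasSymCircuit tcBasis (pointStabiliserBudget m g) (7 * (2 ^ g * g ^ 3))
      (fun x : Fin m × Fin m → Bool =>
        decide (SimpleGraph.fromRel fun u v => x (freeEmb m g hgm u, freeEmb m g hgm v) = true :
          SimpleGraph (Fin g)).IsHamiltonian) :=
  hasSymCircuit_ham_induced hg (freeEmb m g hgm) _ fun _ hρ i => budget_maps_free hgm hρ i

end HeldKarp

end Literature.Computability.Complexity
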